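import Summits.ValiantsHypothesis.ValiantsHypothesis.Theorems.BarrierLeverPartitionMinorsChowSizeFive
import Summits.ValiantsHypothesis.ValiantsHypothesis.Theorems.BarrierLeverPartitionMinorsGenericChowProduct

/-!
# Route BarrierLever — Chow witnesses for partition minors (item 20172, CPM): ONE product of affine
# forms with ALL partition minors of size `≤ 5` nonzero, at every height (and one product hitting
# every layout of height `≤ 3`)

Helper file (`--supports stmt-ValiantsHypothesis-20172`; cell valiant-natproofs, rung V4, 𝒟-side of
door (c); seat val-np-p4 gen 12).  Closes NO item.  The slices `chowHits_of_size_le_five` (every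
injective layout pair of size `r ≤ 5`, every height) and `chowHits_of_height_le_three` give ONE witness
PER LAYOUT; the polynomial method of `…GenericChowProduct` (`exists_common_chow_witness`: finitely many
hit layouts are hit by one common product — a non-root of the product of the generic minors) upgrades
them to a SINGLE witness for all layouts at once, height by height:

* `exists_chow_witness_all_size_le_five` — **for every `h` there is ONE product `∏ ℓ` of `h + h` affine
  forms in `x_1 … x_h, y_1 … y_h` whose Nisan partition matrix `[coeff_{x^U y^W} ∏ ℓ]_{U, W ⊆ Fin h}`
  has EVERY minor of size `≤ 5` on distinct row sets and distinct column sets nonzero**;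
* `exists_chow_witness_all_height_le_three` — for `h ≤ 3` one product hits every injective layout pair
  (every size `r`).

This is the hitting-set shape of the 𝒟-side door (c): a single explicit-degree polynomial (a product of
`2h` affine forms: degree `≤ 2h`, formula size `O(h²)`) fooling all the rank tests of order `≤ 5` at once.

WHAT THIS IS NOT: bounded-size / bounded-height statements; item 20172 asks for minors of every size
`r ≤ 2^h`; nothing on items 20195 / 19717, on crux stmt-ValiantsHypothesis-14610, or on `VP` versus
`VNP`.
-/

set_option linter.dupNamespace false

namespace Summit.ValiantsHypothesis.ValiantsHypothesis.Theorems.BarrierLever.ChowFactor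

open Finset MvPolynomial

noncomputable section

/-- **One witness for all small minors.**  For every height `h` there is a single product of `h + h`
affine forms all of whose partition minors of size `r ≤ 5` (rows `u`, columns `w` injective) are
nonzero. -/
theorem exists_chow_witness_all_size_le_five (h : ℕ) :
    ∃ ℓ : Fin (h + h) → MvPolynomial (Fin (h + h)) ℂ, (∀ q, (ℓ q).totalDegree ≤ 1) ∧
      ∀ (r : ℕ), r ≤ 5 → ∀ (u w : Fin r → Finset (Fin h)), Function.Injective u → Function.Injective w →
        (Matrix.of fun i j : Fin r => coeff
          (∑ b ∈ u i, Finsupp.single (Fin.castAdd h b) 1 + ∑ d ∈ w j, Finsupp.single (Fin.natAdd h d) 1)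
          (∏ q, ℓ q)).det ≠ 0 := by
  classical
  -- index the layouts of size `< 6` by a finite type
  let ι := Σ r : Fin 6, (Fin r → Finset (Fin h)) × (Fin r → Finset (Fin h))
  let S : Finset ι := Finset.univ.filter fun i => Function.Injective i.2.1 ∧ Function.Injective i.2.2
  obtain ⟨ℓ, hℓ, hall⟩ := exists_common_chow_witness S (fun i : ι => (i.1 : ℕ)) (fun i => i.2.1)
    (fun i => i.2.2) (fun i hi => by
      rw [Finset.mem_filter] at hi
      exact chowHits_of_size_le_five h i.1 (by omega) i.2.1 i.2.2 hi.2.1 hi.2.2)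
  refine ⟨ℓ, hℓ, fun r hr u w hu hw => ?_⟩
  exact hall ⟨⟨r, by omega⟩, (u, w)⟩ (Finset.mem_filter.mpr ⟨Finset.mem_univ _, hu, hw⟩)

/-- **One witness for every layout of height `≤ 3`.**  For `h ≤ 3` there is a single product of
`h + h` affine forms all of whose partition minors on distinct row sets and distinct column sets (any
size `r`) are nonzero. -/
theorem exists_chow_witness_all_height_le_three (h : ℕ) (hh : h ≤ 3) :
    ∃ ℓ : Fin (h + h) → MvPolynomial (Fin (h + h)) ℂ, (∀ q, (ℓ q).totalDegree ≤ 1) ∧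
      ∀ (r : ℕ) (u w : Fin r → Finset (Fin h)), Function.Injective u → Function.Injective w →
        (Matrix.of fun i j : Fin r => coeff
          (∑ b ∈ u i, Finsupp.single (Fin.castAdd h b) 1 + ∑ d ∈ w j, Finsupp.single (Fin.natAdd h d) 1)
          (∏ q, ℓ q)).det ≠ 0 := by
  classical
  -- an injective layout has `r ≤ 2^h` rows, so the layouts are indexed by a finite type
  let ι := Σ r : Fin (2 ^ h + 1), (Fin r → Finset (Fin h)) × (Fin r → Finset (Fin h))
  let S : Finset ι := Finset.univ.filter fun i => Function.Injective i.2.1 ∧ Function.Injective i.2.2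
  obtain ⟨ℓ, hℓ, hall⟩ := exists_common_chow_witness S (fun i : ι => (i.1 : ℕ)) (fun i => i.2.1)
    (fun i => i.2.2) (fun i hi => by
      rw [Finset.mem_filter] at hi
      exact chowHits_of_height_le_three h i.1 hh i.2.1 i.2.2 hi.2.1 hi.2.2)
  refine ⟨ℓ, hℓ, fun r u w hu hw => ?_⟩
  have hr : r < 2 ^ h + 1 := by
    have := Fintype.card_le_of_injective u hu
    rw [Fintype.card_fin, Fintype.card_finset, Fintype.card_fin] at this
    omega
  exact hall ⟨⟨r, hr⟩, (u, w)⟩ (Finset.mem_filter.mpr ⟨Finset.mem_univ _, hu, hw⟩)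

end

end Summit.ValiantsHypothesis.ValiantsHypothesis.Theorems.BarrierLever.ChowFactor
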